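import Summits.MatrixMultiplication.MatrixMultiplication.Theorems.AsymptoticRankCWBThesisSkewSplit
import Summits.MatrixMultiplication.MatrixMultiplication.Theorems.AsymptoticRankCWSkewPairRanges
import Literature.Computability.AlgebraicComplexity.AsymptoticSpectrumDuality
import Literature.Computability.AlgebraicComplexity.QuantumFunctionalPointHolds
import Literature.Computability.AlgebraicComplexity.QuantumFunctionalsFree

/-!
# `BSkewDominatesCw` (stmt-MatrixMultiplication-18009) in spectral form, and the quantum functionals
tie at `3` on `T_cw,2` and on the Levi-Civita tensor `ε`

Route `MatrixMultiplication/AsymptoticRankCW`, crux `BThesis` (stmt-MatrixMultiplication-0588), line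
`Cruxes/BThesis/Lines/skew_anchor.lean`, stub `stub_skewDominatesCw` = item `BSkewDominatesCw`
(stmt-18009): `R̃(T_cw,2) ≤ R̃(ε)`, `ε` the Levi-Civita tensor on `Fin 3` written inline as in the route
file (`≅ T_skewcw,2`).

1. **Spectral form** (Strassen duality `R̃(t) = max_{F ∈ Δ(ℂ)} F(t)`, PROVED in tree as
   `strassen_duality_asymptoticRank_holds`): `BSkewDominatesCw ↔ ∀ F ∈ Δ(ℂ), F(T_cw,2) ≤ R̃(ε)`, and the
   pointwise domination `∀ F ∈ Δ(ℂ), F(T_cw,2) ≤ F(ε)` (i.e. `T_cw,2 ≲ ε`) suffices.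
2. **The quantum functionals cannot decide the item either way**: for every `θ` in the probability
   simplex `P([3])`, `F^θ(T_cw,2) = F^θ(ε) = 3` (`quantumFunctionalPoint`), because in suitable bases both
   tensors have the FREE support `{(σ(0),σ(1),σ(2)) : σ ∈ 𝔖₃}` (the CGLV basis for `T_cw,2`,
   `cglv_exists_basis_cwTensor_two`; the standard basis for `ε`), the uniform distribution on the six
   permutation cells has uniform marginals, so `E_θ ≥ H_θ(uniform) = log₂ 3` by the free-support lower
   bound (CVZ Thm. 4.20, proof; tree `weightedEntropy_le_logQuantumFunctional_of_isFreeSet`), while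
   `E_θ ≤ ∑ θᵢ log₂ 3 = log₂ 3` always (CVZ Thm. 3.19.5; tree `logQuantumFunctional_le`). So every point of
   the known part of `Δ(ℂ)` (Christandl–Vrana–Zuiddam, Cor. 3.31: `F^θ ∈ Δ(ℂ)`, tree
   `isUniversalSpectralPoint_quantumFunctionalPoint`) takes the SAME value on the two sides of stmt-18009:
   none refutes it, none proves it with room to spare.
3. **Quantum universality settles the whole line**: if every universal spectral point over `ℂ` is a
   quantum functional (the open question of CVZ §1 = item `AQuantumUniversality` of the sibling route
   `AsymptoticSpectrum`, stmt-MatrixMultiplication-0582, taken here as an explicit hypothesis with that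
   item's body verbatim), then `R̃(T_cw,2) = R̃(ε) = 3`, hence `BSkewDominatesCw`, `BDet3AsymptoticRank`
   (`R̃(ε ⊠ ε) = R̃(ε)² = 9`) and `BThesis` all hold.

All sorry-free; standard axioms. No new definitions (the tensors and the uniform distribution are
written inline; no notation).

References. M. Christandl, P. Vrana, J. Zuiddam, *Universal points in the asymptotic spectrum of
tensors*, J. Amer. Math. Soc. 36 (2023) = arXiv:1709.07851, Prop. 1.6, Thm. 3.19.5, Cor. 3.31,
Thm. 4.20; A. Conner, F. Gesmundo, J. M. Landsberg, E. Ventura, comput. complexity 31 (2022) =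
arXiv:1909.04785, §2.2 and §3.2; V. Strassen, J. reine angew. Math. 384 (1988), Thm. 3.8.
-/

set_option linter.dupNamespace false

noncomputable section

namespace Summit.MatrixMultiplication.MatrixMultiplication.Theorems

open scoped BigOperators
open Literature.Computability.AlgebraicComplexity
open Summit.MatrixMultiplication.MatrixMultiplication.Theses.AsymptoticRankCW

/-! ## 1. Spectral form of the item -/

section SpectralForm

/-- **`BSkewDominatesCw` in spectral form**: `R̃(T_cw,2) ≤ R̃(ε)` iff every universal spectral point
`F ∈ Δ(ℂ)` has `F(T_cw,2) ≤ R̃(ε)` — by Strassen duality `R̃(T_cw,2) = max_{F ∈ Δ(ℂ)} F(T_cw,2)`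
(`strassen_duality_asymptoticRank_holds`); the item's inline `T_cw,2` is `cwTensor ℂ 2` by `rfl`.
[cite: ChristandlVranaZuiddam2023, Prop. 1.6] -/
theorem bSkewDominatesCw_iff_forall_spectralPoint_le :
    BSkewDominatesCw ↔ ∀ F : SpectralMap ℂ, IsUniversalSpectralPoint ℂ F →
      F (cwTensor ℂ 2) ≤ asymptoticRank (fun a b c : Fin 3 => (if b = a + 1 ∧ c = a + 2 then (1 : ℂ) else 0) - (if b = a + 2 ∧ c = a + 1 then 1 else 0)) := by
  unfold Summit.MatrixMultiplication.MatrixMultiplication.Theses.AsymptoticRankCW.BSkewDominatesCw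
  have hd := strassen_duality_asymptoticRank_holds ℂ (cwTensor ℂ 2)
  constructor
  · intro h F hF
    exact (hd.1 F hF).trans h
  · intro h
    obtain ⟨F, hF, hFeq⟩ := hd.2
    have := h F hF
    rw [hFeq] at this
    exact this

/-- **Pointwise spectral domination suffices**: if `F(T_cw,2) ≤ F(ε)` for every `F ∈ Δ(ℂ)` (i.e.
`T_cw,2 ≲ ε` in the asymptotic preorder), then `BSkewDominatesCw`, since `F(ε) ≤ R̃(ε)`.
[cite: ChristandlVranaZuiddam2023, Prop. 1.6] -/
theorem bSkewDominatesCw_of_forall_spectralPoint_le_spectralPoint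
    (h : ∀ F : SpectralMap ℂ, IsUniversalSpectralPoint ℂ F → F (cwTensor ℂ 2) ≤ F (fun a b c : Fin 3 => (if b = a + 1 ∧ c = a + 2 then (1 : ℂ) else 0) - (if b = a + 2 ∧ c = a + 1 then 1 else 0))) :
    BSkewDominatesCw := by
  rw [bSkewDominatesCw_iff_forall_spectralPoint_le]
  intro F hF
  exact (h F hF).trans ((strassen_duality_asymptoticRank_holds ℂ (fun a b c : Fin 3 => (if b = a + 1 ∧ c = a + 2 then (1 : ℂ) else 0) - (if b = a + 2 ∧ c = a + 1 then 1 else 0))).1 F hF)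

end SpectralForm

/-! ## 2. The quantum functionals take the value `3` on both tensors -/

section Combinatorics

/-- The six permutation cells form a FREE set (CVZ Def. 4.17): two coordinates of a permutation of
`(0,1,2)` determine the third. [cite: ChristandlVranaZuiddam2023, Def. 4.17] -/
theorem isFreeSet_permCells : IsFreeSet ({p : Fin 3 × Fin 3 × Fin 3 | p.1 ≠ p.2.1 ∧ p.2.1 ≠ p.2.2 ∧ p.1 ≠ p.2.2} : Set (Fin 3 × Fin 3 × Fin 3)) := by
  rw [isFreeSet_iff]
  decide

/-- `(fun p : Fin 3 × Fin 3 × Fin 3 => if (p.1 ≠ p.2.1 ∧ p.2.1 ≠ p.2.2 ∧ p.1 ≠ p.2.2) then (1 / 6 : ℝ) else 0)` is a probability distribution. [folklore] -/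
theorem permUniform_mem_stdSimplex : (fun p : Fin 3 × Fin 3 × Fin 3 => if (p.1 ≠ p.2.1 ∧ p.2.1 ≠ p.2.2 ∧ p.1 ≠ p.2.2) then (1 / 6 : ℝ) else 0) ∈ stdSimplex ℝ (Fin 3 × Fin 3 × Fin 3) := by
  refine ⟨fun p => ?_, ?_⟩
  · dsimp only
    split_ifs <;> norm_num
  · simp [Fintype.sum_prod_type, Fin.sum_univ_three]
    norm_num

/-- The support of `(fun p : Fin 3 × Fin 3 × Fin 3 => if (p.1 ≠ p.2.1 ∧ p.2.1 ≠ p.2.2 ∧ p.1 ≠ p.2.2) then (1 / 6 : ℝ) else 0)` is contained in (indeed equals) the permutation cells. [folklore] -/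
theorem support_permUniform_subset : Function.support (fun p : Fin 3 × Fin 3 × Fin 3 => if (p.1 ≠ p.2.1 ∧ p.2.1 ≠ p.2.2 ∧ p.1 ≠ p.2.2) then (1 / 6 : ℝ) else 0) ⊆ ({p : Fin 3 × Fin 3 × Fin 3 | p.1 ≠ p.2.1 ∧ p.2.1 ≠ p.2.2 ∧ p.1 ≠ p.2.2} : Set (Fin 3 × Fin 3 × Fin 3)) := by
  intro p hp
  rw [Function.mem_support] at hp
  by_contra h
  exact hp (if_neg h)

/-- First marginal of `(fun p : Fin 3 × Fin 3 × Fin 3 => if (p.1 ≠ p.2.1 ∧ p.2.1 ≠ p.2.2 ∧ p.1 ≠ p.2.2) then (1 / 6 : ℝ) else 0)` is uniform on `Fin 3`. [folklore] -/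
theorem marginalDist₁_permUniform : marginalDist₁ (fun p : Fin 3 × Fin 3 × Fin 3 => if (p.1 ≠ p.2.1 ∧ p.2.1 ≠ p.2.2 ∧ p.1 ≠ p.2.2) then (1 / 6 : ℝ) else 0) = fun _ => (1 / 3 : ℝ) := by
  funext a
  fin_cases a <;> simp [marginalDist₁, Fin.sum_univ_three] <;> norm_num

/-- Second marginal of `(fun p : Fin 3 × Fin 3 × Fin 3 => if (p.1 ≠ p.2.1 ∧ p.2.1 ≠ p.2.2 ∧ p.1 ≠ p.2.2) then (1 / 6 : ℝ) else 0)` is uniform on `Fin 3`. [folklore] -/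
theorem marginalDist₂_permUniform : marginalDist₂ (fun p : Fin 3 × Fin 3 × Fin 3 => if (p.1 ≠ p.2.1 ∧ p.2.1 ≠ p.2.2 ∧ p.1 ≠ p.2.2) then (1 / 6 : ℝ) else 0) = fun _ => (1 / 3 : ℝ) := by
  funext b
  fin_cases b <;> simp [marginalDist₂, Fin.sum_univ_three] <;> norm_num

/-- Third marginal of `(fun p : Fin 3 × Fin 3 × Fin 3 => if (p.1 ≠ p.2.1 ∧ p.2.1 ≠ p.2.2 ∧ p.1 ≠ p.2.2) then (1 / 6 : ℝ) else 0)` is uniform on `Fin 3`. [folklore] -/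
theorem marginalDist₃_permUniform : marginalDist₃ (fun p : Fin 3 × Fin 3 × Fin 3 => if (p.1 ≠ p.2.1 ∧ p.2.1 ≠ p.2.2 ∧ p.1 ≠ p.2.2) then (1 / 6 : ℝ) else 0) = fun _ => (1 / 3 : ℝ) := by
  funext c
  fin_cases c <;> simp [marginalDist₃, Fin.sum_univ_three] <;> norm_num

/-- `H(uniform on 3 points) = log₂ 3`. [folklore] -/
theorem shannonEntropy_uniform_three :
    shannonEntropy (fun _ : Fin 3 => (1 / 3 : ℝ)) = Real.log 3 / Real.log 2 := by
  have h : Real.log ((1 : ℝ) / 3) = -Real.log 3 := by rw [one_div, Real.log_inv]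
  simp only [shannonEntropy, Real.negMulLog, Finset.sum_const, Finset.card_univ, Fintype.card_fin,
    nsmul_eq_mul, h]
  push_cast
  ring

/-- `H_θ((fun p : Fin 3 × Fin 3 × Fin 3 => if (p.1 ≠ p.2.1 ∧ p.2.1 ≠ p.2.2 ∧ p.1 ≠ p.2.2) then (1 / 6 : ℝ) else 0)) = (θ₀ + θ₁ + θ₂) log₂ 3`: all three marginals of `(fun p : Fin 3 × Fin 3 × Fin 3 => if (p.1 ≠ p.2.1 ∧ p.2.1 ≠ p.2.2 ∧ p.1 ≠ p.2.2) then (1 / 6 : ℝ) else 0)` are uniform. [folklore] -/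
theorem weightedEntropy_permUniform (θ : Fin 3 → ℝ) :
    weightedEntropy θ (fun p : Fin 3 × Fin 3 × Fin 3 => if (p.1 ≠ p.2.1 ∧ p.2.1 ≠ p.2.2 ∧ p.1 ≠ p.2.2) then (1 / 6 : ℝ) else 0) = (θ 0 + θ 1 + θ 2) * (Real.log 3 / Real.log 2) := by
  simp only [weightedEntropy, marginalDist₁_permUniform, marginalDist₂_permUniform,
    marginalDist₃_permUniform, shannonEntropy_uniform_three]
  ring

/-- `2^{log₂ 3} = 3`. [folklore] -/
theorem two_rpow_log_three_div_log_two : (2 : ℝ) ^ (Real.log 3 / Real.log 2) = 3 := by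
  have : Real.log 3 / Real.log 2 = Real.logb 2 3 := rfl
  rw [this]
  exact Real.rpow_logb two_pos (by norm_num) three_pos

end Combinatorics

section QuantumValue

/-- **Core evaluation**: a nonzero tensor `t ∈ ℂ³ ⊗ ℂ³ ⊗ ℂ³` whose support in some bases
`(A,B,C) ∈ GL₃(ℂ)³` is exactly the six permutation cells has `F^θ(t) = 3` for every `θ ∈ P([3])`:
`E_θ(t) ≥ H_θ((fun p : Fin 3 × Fin 3 × Fin 3 => if (p.1 ≠ p.2.1 ∧ p.2.1 ≠ p.2.2 ∧ p.1 ≠ p.2.2) then (1 / 6 : ℝ) else 0)) = log₂ 3` by the free-support lower bound (CVZ Thm. 4.20, proof) and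
`E_θ(t) ≤ ∑ᵢ θᵢ log₂ 3 = log₂ 3` (CVZ Thm. 3.19.5). [cite: ChristandlVranaZuiddam2023, Thm. 4.20] -/
theorem quantumFunctional_eq_three_of_support_eq_permCells {θ : Fin 3 → ℝ}
    (hθ : θ ∈ stdSimplex ℝ (Fin 3)) {t : Fin 3 → Fin 3 → Fin 3 → ℂ} (ht : t ≠ 0)
    (g₀ : GL (Fin 3) ℂ × GL (Fin 3) ℂ × GL (Fin 3) ℂ)
    (hsupp : tensorSupport (actTensor (g₀.1 : Matrix (Fin 3) (Fin 3) ℂ)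
      (g₀.2.1 : Matrix (Fin 3) (Fin 3) ℂ) (g₀.2.2 : Matrix (Fin 3) (Fin 3) ℂ) t) = ({p : Fin 3 × Fin 3 × Fin 3 | p.1 ≠ p.2.1 ∧ p.2.1 ≠ p.2.2 ∧ p.1 ≠ p.2.2} : Set (Fin 3 × Fin 3 × Fin 3))) :
    quantumFunctional θ t = 3 := by
  have hθ0 : ∀ i, 0 ≤ θ i := fun i => hθ.1 i
  have hsum : θ 0 + θ 1 + θ 2 = 1 := by
    have := hθ.2
    simpa [Fin.sum_univ_three] using this
  -- lower bound `log₂ 3 ≤ E_θ(t)` from the uniform distribution on the free support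
  have hfree : IsFreeSet (tensorSupport (actTensor (g₀.1 : Matrix (Fin 3) (Fin 3) ℂ)
      (g₀.2.1 : Matrix (Fin 3) (Fin 3) ℂ) (g₀.2.2 : Matrix (Fin 3) (Fin 3) ℂ) t)) := by
    rw [hsupp]
    exact isFreeSet_permCells
  have hPs : Function.support (fun p : Fin 3 × Fin 3 × Fin 3 => if (p.1 ≠ p.2.1 ∧ p.2.1 ≠ p.2.2 ∧ p.1 ≠ p.2.2) then (1 / 6 : ℝ) else 0) ⊆ tensorSupport (actTensor (g₀.1 : Matrix (Fin 3) (Fin 3) ℂ)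
      (g₀.2.1 : Matrix (Fin 3) (Fin 3) ℂ) (g₀.2.2 : Matrix (Fin 3) (Fin 3) ℂ) t) := by
    rw [hsupp]
    exact support_permUniform_subset
  have hlow := weightedEntropy_le_logQuantumFunctional_of_isFreeSet hθ0 t g₀ hfree
    permUniform_mem_stdSimplex hPs
  rw [weightedEntropy_permUniform, hsum, one_mul] at hlow
  -- upper bound `E_θ(t) ≤ log₂ 3`
  have hup : logQuantumFunctional θ t ≤ Real.log 3 / Real.log 2 := by
    have := logQuantumFunctional_le hθ0 t
    simp only [Fintype.card_fin, Nat.cast_ofNat] at this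
    calc logQuantumFunctional θ t ≤ θ 0 * (Real.log 3 / Real.log 2) +
        θ 1 * (Real.log 3 / Real.log 2) + θ 2 * (Real.log 3 / Real.log 2) := this
      _ = (θ 0 + θ 1 + θ 2) * (Real.log 3 / Real.log 2) := by ring
      _ = Real.log 3 / Real.log 2 := by rw [hsum, one_mul]
  have heq : logQuantumFunctional θ t = Real.log 3 / Real.log 2 := le_antisymm hup hlow
  rw [quantumFunctional_of_ne_zero θ ht, heq, two_rpow_log_three_div_log_two]

/-- The inline Levi-Civita tensor is nonzero (`ε₀₁₂ = 1`). [folklore] -/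
theorem leviCivitaInline_ne_zero : (fun a b c : Fin 3 => (if b = a + 1 ∧ c = a + 2 then (1 : ℂ) else 0) - (if b = a + 2 ∧ c = a + 1 then 1 else 0)) ≠ 0 := by
  intro h
  have := congrFun (congrFun (congrFun h 0) 1) 2
  simp at this

/-- In the standard bases the support of `ε` is exactly the six permutation cells. [folklore] -/
theorem tensorSupport_leviCivitaInline : tensorSupport (fun a b c : Fin 3 => (if b = a + 1 ∧ c = a + 2 then (1 : ℂ) else 0) - (if b = a + 2 ∧ c = a + 1 then 1 else 0)) = ({p : Fin 3 × Fin 3 × Fin 3 | p.1 ≠ p.2.1 ∧ p.2.1 ≠ p.2.2 ∧ p.1 ≠ p.2.2} : Set (Fin 3 × Fin 3 × Fin 3)) := by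
  ext ⟨a, b, c⟩
  simp only [mem_tensorSupport, Set.mem_setOf_eq]
  fin_cases a <;> fin_cases b <;> fin_cases c <;> simp

/-- `T_cw,2 ≠ 0` (entry `(0,1,1)` is `1`). [folklore] -/
theorem cwTensor_two_ne_zero : cwTensor ℂ 2 ≠ 0 := by
  intro h
  have := congrFun (congrFun (congrFun h 0) 1) 1
  simp [cwTensor] at this

/-- In the CGLV bases `(A,A,A)` (`(A,A,A)·T_cw,2 = 2|ε_{ijk}|`) the support of `T_cw,2` is exactly
the six permutation cells. [cite: ConnerGesmundoLandsbergVentura2022, §3.2 (proof of Lemma 2.4)] -/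
theorem tensorSupport_act_cwTensor_two_eq {A : Matrix (Fin 3) (Fin 3) ℂ}
    (hA : ∀ i j k : Fin 3, ∑ i', ∑ j', ∑ k', A i i' * A j j' * A k k' * cwTensor ℂ 2 i' j' k' =
      2 * ((|leviCivita3 i j k| : ℤ) : ℂ)) :
    tensorSupport (actTensor A A A (cwTensor ℂ 2)) = ({p : Fin 3 × Fin 3 × Fin 3 | p.1 ≠ p.2.1 ∧ p.2.1 ≠ p.2.2 ∧ p.1 ≠ p.2.2} : Set (Fin 3 × Fin 3 × Fin 3)) := by
  ext ⟨i, j, k⟩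
  simp only [mem_tensorSupport, actTensor_apply, hA, abs_leviCivita3, Set.mem_setOf_eq]
  by_cases h : (i ≠ j ∧ j ≠ k ∧ i ≠ k)
  · simp [h]
  · rw [if_neg h]
    simp only [Int.cast_zero, mul_zero, ne_eq, not_true_eq_false, false_iff]
    exact h

/-- **`F^θ(ε) = 3` for every `θ ∈ P([3])`** (Levi-Civita tensor, inline as in the route file).
[cite: ChristandlVranaZuiddam2023, Thm. 4.20] -/
theorem quantumFunctional_leviCivitaInline_eq_three {θ : Fin 3 → ℝ}
    (hθ : θ ∈ stdSimplex ℝ (Fin 3)) : quantumFunctional θ (fun a b c : Fin 3 => (if b = a + 1 ∧ c = a + 2 then (1 : ℂ) else 0) - (if b = a + 2 ∧ c = a + 1 then 1 else 0)) = 3 := by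
  refine quantumFunctional_eq_three_of_support_eq_permCells hθ leviCivitaInline_ne_zero
    ((1 : GL (Fin 3) ℂ), (1 : GL (Fin 3) ℂ), (1 : GL (Fin 3) ℂ)) ?_
  simpa using tensorSupport_leviCivitaInline

/-- **`F^θ(T_cw,2) = 3` for every `θ ∈ P([3])`** (small Coppersmith–Winograd tensor).
[cite: ChristandlVranaZuiddam2023, Thm. 4.20] -/
theorem quantumFunctional_cwTensor_two_eq_three {θ : Fin 3 → ℝ}
    (hθ : θ ∈ stdSimplex ℝ (Fin 3)) : quantumFunctional θ (cwTensor ℂ 2) = 3 := by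
  obtain ⟨A, hAdet, hA⟩ := cglv_exists_basis_cwTensor_two
  refine quantumFunctional_eq_three_of_support_eq_permCells hθ cwTensor_two_ne_zero
    (Matrix.GeneralLinearGroup.mkOfDetNeZero A hAdet, Matrix.GeneralLinearGroup.mkOfDetNeZero A hAdet,
      Matrix.GeneralLinearGroup.mkOfDetNeZero A hAdet) ?_
  simp only [Matrix.GeneralLinearGroup.val_mkOfDetNeZero]
  exact tensorSupport_act_cwTensor_two_eq hA

/-- **The quantum functional POINTS tie**: `quantumFunctionalPoint θ (T_cw,2) = 3`.
[cite: ChristandlVranaZuiddam2023, Thm. 4.20] -/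
theorem quantumFunctionalPoint_cwTensor_two_eq_three {θ : Fin 3 → ℝ}
    (hθ : θ ∈ stdSimplex ℝ (Fin 3)) : quantumFunctionalPoint θ (cwTensor ℂ 2) = 3 := by
  rw [quantumFunctionalPoint_apply]
  exact quantumFunctional_cwTensor_two_eq_three hθ

/-- **The quantum functional POINTS tie**: `quantumFunctionalPoint θ ε = 3`.
[cite: ChristandlVranaZuiddam2023, Thm. 4.20] -/
theorem quantumFunctionalPoint_leviCivitaInline_eq_three {θ : Fin 3 → ℝ}
    (hθ : θ ∈ stdSimplex ℝ (Fin 3)) : quantumFunctionalPoint θ (fun a b c : Fin 3 => (if b = a + 1 ∧ c = a + 2 then (1 : ℂ) else 0) - (if b = a + 2 ∧ c = a + 1 then 1 else 0)) = 3 := by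
  rw [quantumFunctionalPoint_apply]
  exact quantumFunctional_leviCivitaInline_eq_three hθ

/-- **No quantum functional separates the two sides of stmt-18009**:
`F^θ(T_cw,2) = F^θ(ε)` for every `θ ∈ P([3])`; in particular no `F^θ` refutes `BSkewDominatesCw`
(which would need `F^θ(T_cw,2) > R̃(ε) ≥ F^θ(ε)`) and none certifies the pointwise domination strictly.
[cite: ChristandlVranaZuiddam2023, Cor. 3.31] -/
theorem quantumFunctionalPoint_cwTensor_two_eq_leviCivitaInline {θ : Fin 3 → ℝ}
    (hθ : θ ∈ stdSimplex ℝ (Fin 3)) :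
    quantumFunctionalPoint θ (cwTensor ℂ 2) = quantumFunctionalPoint θ (fun a b c : Fin 3 => (if b = a + 1 ∧ c = a + 2 then (1 : ℂ) else 0) - (if b = a + 2 ∧ c = a + 1 then 1 else 0)) := by
  rw [quantumFunctionalPoint_cwTensor_two_eq_three hθ, quantumFunctionalPoint_leviCivitaInline_eq_three hθ]

/-- Every quantum functional sits at the flattening value on both tensors:
`F^θ(T_cw,2) = 3 ≤ R̃(T_cw,2)` and `F^θ(ε) = 3 ≤ R̃(ε)` — the known part of `Δ(ℂ)` gives exactly the
flattening lower bound `3` on each side and nothing more. [cite: ChristandlVranaZuiddam2023, §1.1 (p. 4)] -/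
theorem quantumFunctionalPoint_le_asymptoticRank_both {θ : Fin 3 → ℝ}
    (hθ : θ ∈ stdSimplex ℝ (Fin 3)) :
    quantumFunctionalPoint θ (cwTensor ℂ 2) ≤ asymptoticRank (cwTensor ℂ 2) ∧
      quantumFunctionalPoint θ (fun a b c : Fin 3 => (if b = a + 1 ∧ c = a + 2 then (1 : ℂ) else 0) - (if b = a + 2 ∧ c = a + 1 then 1 else 0)) ≤ asymptoticRank (fun a b c : Fin 3 => (if b = a + 1 ∧ c = a + 2 then (1 : ℂ) else 0) - (if b = a + 2 ∧ c = a + 1 then 1 else 0)) :=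
  ⟨(strassen_duality_asymptoticRank_holds ℂ (cwTensor ℂ 2)).1 _
      (isUniversalSpectralPoint_quantumFunctionalPoint hθ),
    (strassen_duality_asymptoticRank_holds ℂ (fun a b c : Fin 3 => (if b = a + 1 ∧ c = a + 2 then (1 : ℂ) else 0) - (if b = a + 2 ∧ c = a + 1 then 1 else 0))).1 _
      (isUniversalSpectralPoint_quantumFunctionalPoint hθ)⟩

end QuantumValue

/-! ## 3. Quantum universality settles the whole line -/

section Universality

/-- **Quantum universality ⇒ `R̃(T_cw,2) = 3`.** If every universal spectral point over `ℂ` is a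
quantum functional `F^θ` (the hypothesis is the body of item `AQuantumUniversality`,
stmt-MatrixMultiplication-0582, sibling route `AsymptoticSpectrum`; an OPEN question of CVZ §1), then
the `F ∈ Δ(ℂ)` attaining `R̃(T_cw,2)` (duality) equals `3` there. [cite: ChristandlVranaZuiddam2023, Prop. 1.6] -/
theorem asymptoticRank_cwTensor_two_eq_three_of_quantumUniversality
    (hU : ∀ F : SpectralMap ℂ, IsUniversalSpectralPoint ℂ F → ∃ θ ∈ stdSimplex ℝ (Fin 3),
      ∀ ⦃ι κ μ : Type⦄ [Fintype ι] [Fintype κ] [Fintype μ] (t : ι → κ → μ → ℂ),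
        F t = quantumFunctionalPoint θ t) :
    asymptoticRank (cwTensor ℂ 2) = 3 := by
  obtain ⟨F, hF, hFeq⟩ := (strassen_duality_asymptoticRank_holds ℂ (cwTensor ℂ 2)).2
  obtain ⟨θ, hθ, hFθ⟩ := hU F hF
  rw [← hFeq, hFθ (cwTensor ℂ 2), quantumFunctionalPoint_cwTensor_two_eq_three hθ]

/-- **Quantum universality ⇒ `R̃(ε) = 3`.** [cite: ChristandlVranaZuiddam2023, Prop. 1.6] -/
theorem asymptoticRank_leviCivitaInline_eq_three_of_quantumUniversality
    (hU : ∀ F : SpectralMap ℂ, IsUniversalSpectralPoint ℂ F → ∃ θ ∈ stdSimplex ℝ (Fin 3),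
      ∀ ⦃ι κ μ : Type⦄ [Fintype ι] [Fintype κ] [Fintype μ] (t : ι → κ → μ → ℂ),
        F t = quantumFunctionalPoint θ t) :
    asymptoticRank (fun a b c : Fin 3 => (if b = a + 1 ∧ c = a + 2 then (1 : ℂ) else 0) - (if b = a + 2 ∧ c = a + 1 then 1 else 0)) = 3 := by
  obtain ⟨F, hF, hFeq⟩ := (strassen_duality_asymptoticRank_holds ℂ (fun a b c : Fin 3 => (if b = a + 1 ∧ c = a + 2 then (1 : ℂ) else 0) - (if b = a + 2 ∧ c = a + 1 then 1 else 0))).2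
  obtain ⟨θ, hθ, hFθ⟩ := hU F hF
  rw [← hFeq, hFθ, quantumFunctionalPoint_leviCivitaInline_eq_three hθ]

/-- **Quantum universality ⇒ `BSkewDominatesCw`** (stmt-18009): both sides equal `3`.
[cite: ChristandlVranaZuiddam2023, Prop. 1.6] -/
theorem bSkewDominatesCw_of_quantumUniversality
    (hU : ∀ F : SpectralMap ℂ, IsUniversalSpectralPoint ℂ F → ∃ θ ∈ stdSimplex ℝ (Fin 3),
      ∀ ⦃ι κ μ : Type⦄ [Fintype ι] [Fintype κ] [Fintype μ] (t : ι → κ → μ → ℂ),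
        F t = quantumFunctionalPoint θ t) :
    BSkewDominatesCw := by
  unfold Summit.MatrixMultiplication.MatrixMultiplication.Theses.AsymptoticRankCW.BSkewDominatesCw
  have h1 := asymptoticRank_cwTensor_two_eq_three_of_quantumUniversality hU
  have h2 := asymptoticRank_leviCivitaInline_eq_three_of_quantumUniversality hU
  rw [h2]
  exact h1.le

/-- **Quantum universality ⇒ `BDet3AsymptoticRank`** (stmt-0591, the line's other stub):
`R̃(ε ⊠ ε) = R̃(ε)² = 3² = 9` (`asymptoticRank_leviCivita_sq_eq_sq`). [cite: ChristandlVranaZuiddam2023, Prop. 1.6] -/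
theorem bDet3AsymptoticRank_of_quantumUniversality
    (hU : ∀ F : SpectralMap ℂ, IsUniversalSpectralPoint ℂ F → ∃ θ ∈ stdSimplex ℝ (Fin 3),
      ∀ ⦃ι κ μ : Type⦄ [Fintype ι] [Fintype κ] [Fintype μ] (t : ι → κ → μ → ℂ),
        F t = quantumFunctionalPoint θ t) :
    BDet3AsymptoticRank := by
  unfold Summit.MatrixMultiplication.MatrixMultiplication.Theses.AsymptoticRankCW.BDet3AsymptoticRank
  rw [asymptoticRank_leviCivita_sq_eq_sq,
    asymptoticRank_leviCivitaInline_eq_three_of_quantumUniversality hU]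
  norm_num

/-- **Quantum universality ⇒ `BThesis`** (the crux, stmt-0588): `R̃(T_cw,2) = 3 ≤ 3` and
`bThesis_iff_asymptoticRank_cwTensor_le_three`. So the CVZ universality question (item 0582 of route
`AsymptoticSpectrum`) closes this route's target and both stubs of line `skew_anchor` at once.
[cite: ChristandlVranaZuiddam2023, Prop. 1.6] -/
theorem bThesis_of_quantumUniversality
    (hU : ∀ F : SpectralMap ℂ, IsUniversalSpectralPoint ℂ F → ∃ θ ∈ stdSimplex ℝ (Fin 3),
      ∀ ⦃ι κ μ : Type⦄ [Fintype ι] [Fintype κ] [Fintype μ] (t : ι → κ → μ → ℂ),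
        F t = quantumFunctionalPoint θ t) :
    BThesis :=
  bThesis_iff_asymptoticRank_cwTensor_le_three.2
    (asymptoticRank_cwTensor_two_eq_three_of_quantumUniversality hU).le

end Universality

end Summit.MatrixMultiplication.MatrixMultiplication.Theorems

end
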